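import Summits.BirchSwinnertonDyer.BirchSwinnertonDyer.Theorems.ErratumRoadFiveJSWControlMultOfFacts
import Summits.BirchSwinnertonDyer.BirchSwinnertonDyer.Theorems.UniversalToricDescentTwinTorsionRankOne
import Literature.NumberTheory.EllipticCurves.LeadingTermProofs
import Literature.NumberTheory.EllipticCurves.ComplexMultiplication
import HarnessLib

/-!
# Route `UniversalToricDescent`, cruxes `TwinSplitIMCAtThreeMult` (stmt-BirchSwinnertonDyer-20694, bucket B) and ♭B
# `TwinWanFrameAtThreeMult` (stmt-BirchSwinnertonDyer-26062), lines `threeframes` v5–v7 / `membertower` v2–v4, research stub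
# `stub_torsionMult` («`X^∅_ac(W′/K_∞; slot 𝔭′)` is `Λ`-torsion»): it is PRINT on the WHOLE locus `r(W′/K) = 1` — keyed
# ALGEBRAICALLY (`rank W′(K) = 1`, `Ш(W′/K)[3^∞]` finite; modulo the two Poitou–Tate facts only) and ANALYTICALLY
# (`ord_{s=1} L(W′/K, s) = 1`, i.e. the (1,0)- AND the (0,1)-locus; modulo GZK ∕ newforms ∕ Poitou–Tate ×2)

Cell `bsd-wall` (run/shared/lean/pub/bsd-wall/), width seat `bsd-wall-utd-p2-w2` (prover g3, 2026-08-28);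
`--supports stmt-BirchSwinnertonDyer-20694 --as helper`.

## Context (numbers, not adjectives)

p613967 (`…TwinTorsionRankOne`, w2 g2) proved the torsion atom on the (1,0)-locus «`r_an(W′) = 1 ∧ L(W′^{(d_K)},1) ≠ 0`»
through corner3-p2's `X11b.controlOnTreeAt_of_mult_of_rankOne_odd`, whose only use of the two analytic binders is the line
`mordellWeilRank_eq_one_and_shaFinite_of_twist` (`rank W(K) = 1`, `Ш(W/K)` finite). The (0,1)-locus «`L(W′,1) ≠ 0 ∧
r_an(W′^{(d_K)}) = 1`» was recorded as needing an `X_ac`-transport along the `K`-isomorphism `W′_K ≅ W′^{(d_K)}_K` (no tree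
API). It does not: bsd-stepL's `JSWControl.controlOnTreeAt_of_mult_of_rankOne_shaPrimary` (p-file
`ErratumRoadFiveJSWControlMultOfFacts`) is the SAME control theorem keyed by `rank E(K) = 1` and `#Ш(E/K)[p^∞] < ∞` (JSW17
Thm. 3.3.1's own inputs), and the quadratic base-change identities `rank E(K) = rank E(ℚ) + rank E^{(d_K)}(ℚ)`
(`mordellWeilRank_baseChange_quadratic_holds`), `Ш(E/ℚ), Ш(E^{(d_K)}/ℚ)` finite ⟹ `Ш(E/K)` finite
(`shaFinite_baseChange_of_shaFinite`) and `ord L(E/K) = ord L(E) + ord L(E^{(d_K)})` (`analyticRankEK_eq_add_of`) are tree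
THEOREMS symmetric in the two factors. So:

* §1 `isTorsion_XAc_empty_of_mult_of_rankOneK_of_poitouTate` — `E/ℚ` globally minimal, odd multiplicative `p`, `K` imaginary
  quadratic with `p` split, `rank E(K) = 1`, `Ш(E/K)[p^∞]` finite, anticyclotomic `(κ, γ)`, ANY `v ∋ p`:
  `X^∅_ac(E/K_∞; slot v)` is `Λ`-torsion — modulo `hPT`, `hPT2` ONLY (no GZK, no modularity; the non-torsion point is
  produced from the rank, `exists_not_isOfFinAddOrder_of_one_le_finrank`). `…_of_shaFinite`: the same from `Ш(E/K)` finite.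
* §2 `mordellWeilRank_eq_one_and_shaFinite_of_analyticRank_zero_of_twist_one` — the (0,1)-locus: `r_an(E) = 0`,
  `r_an(E^{(d_K)}) = 1` ⟹ `rank E(K) = 1 ∧ Ш(E/K)` finite (GZK over `ℚ` twice);
  `mordellWeilRank_eq_one_and_shaFinite_of_analyticRankEK_eq_one` — `ord_{s=1} L(E/K,s) = 1` ⟹ the same (both loci).
* §3 `isTorsion_XAc_empty_of_mult_of_analyticRankEK_eq_one_of_facts` — torsion at any odd multiplicative `p` from
  `analyticRankEK E K = 1`, modulo GZK ∕ `hnf` ∕ `hPT` ∕ `hPT2`.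
* §4 the TWIN (`p = 3`, binders of `stub_torsionMult` VERBATIM: `Mult W′ 3`, conductor `N′`, `SatisfiesHeegnerHypothesis N′ K`
  ⟹ 3 split): `twin_isTorsion_XAc_empty_of_rankOneK_of_poitouTate` (+ `rank W′(K) = 1`, `Ш(W′/K)[3^∞]` finite; PT ×2),
  `twin_isTorsion_XAc_empty_of_analyticRankEK_eq_one_of_facts` (+ `analyticRankEK W′ K = 1`; four facts),
  `twin_isTorsion_XAc_empty_of_analyticRank_zero_of_twist_one_of_facts` (the (0,1)-locus explicitly), and the Road-FF
  `Σ`-data versions `twin_sigmaDataMult_of_rankOneK_of_poitouTate` / `twin_sigmaDataMult_of_analyticRankEK_eq_one_of_facts`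
  (via p613967's `twin_sigmaDataAt_of_isTorsion_empty'`, whose published binders are discharged).

NET for the line: the research content of `stub_torsionMult` is confined to twins with `rank W′(K) ≠ 1` or `Ш(W′/K)[3^∞]`
infinite (algebraic key, PT ×2), resp. `ord_{s=1} L(W′/K,s) ≠ 1` — under the Heegner hypothesis the order is odd, so
`≥ 3` (analytic key, four facts). HONEST FRAMING: theorems only (no definition, no named fact, no instance, no `sorry`);
CONDITIONAL on the cited facts displayed as hypotheses; nothing is booked; BSD is proved for no curve; no census number moves.

References: [JetchevSkinnerWan2017] Thm. 3.3.1, §3.5 (3.5.c), §7.4.1 (arXiv:1512.06894 pp. 11, 15, 30); [Castella2018]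
Thm. 2.3 (arXiv:1704.06608 p. 5); [GrossZagier1986] I.§7, Thm. I.6.3; [Kolyvagin1990] Thm. A; [SilvermanAEC2009] Ex. 10.16;
[DokchitserDokchitserAnnals2010] Lemma 4.14; [MilneADT2006] I Thm. 4.10, Thm. 2.8.
-/

noncomputable section

open scoped Classical

set_option linter.dupNamespace false
set_option autoImplicit false

namespace Summit.BirchSwinnertonDyer.BirchSwinnertonDyer.Theorems.UniversalToricDescentTwinTorsionRankOneK

open WeierstrassCurve NumberField IsDedekindDomain Field
  Literature.NumberTheory.EllipticCurves Literature.NumberTheory.EllipticCurves.ModularForms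
  Literature.NumberTheory.EllipticCurves.Rank1Residual Literature.NumberTheory.EllipticCurves.Castella2018
  Literature.NumberTheory.EllipticCurves.JetchevSkinnerWan2017 Literature.NumberTheory.GaloisCohomology
  Summit.BirchSwinnertonDyer.Rank1Residual Summit.BirchSwinnertonDyer.Rank1Residual.X11b
  Summit.BirchSwinnertonDyer.Rank1Residual.X11b.AcSelmer
  Summit.BirchSwinnertonDyer.BirchSwinnertonDyer.Theorems.UniversalToricDescentTwinTorsionRankOne

/-! ### §1 Torsion of `X^∅_ac` at a multiplicative odd `p` from `rank E(K) = 1` and `Ш(E/K)[p^∞]` finite — PT ×2 only -/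

section Algebraic

variable (W : WeierstrassCurve ℚ) [W.IsElliptic] [W.IsGloballyMinimal] (p : ℕ) [Fact p.Prime]
  {K : Type} [Field K] [NumberField K]

/-- **`X^∅_ac(E/K_∞; slot v)` IS `Λ`-TORSION from the ALGEBRAIC rank-one data over `K`** — `E/ℚ` globally minimal, `p` odd with
`Mult E p`, `K` imaginary quadratic with `p` split, `rank E(K) = 1`, `Ш(E/K)[p^∞]` finite, `κ` anticyclotomic with generator
`γ`, ANY prime `v ∋ p`: the first conjunct of `XAc.HasCharValuationAt` inside bsd-stepL's
`JSWControl.controlOnTreeAt_of_mult_of_rankOne_shaPrimary` (Cas18 Thm. 2.3 / JSW17 Thm. 3.3.1 on the constructed `X_ac`, keyed by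
JSW's own inputs; image-free, local-torsion-free), at the degree-one prime `v` (`degreeOne_of_splitsIn`); the non-torsion point
it wants is PRODUCED from `rank E(K) = 1` (`exists_not_isOfFinAddOrder_of_one_le_finrank`). CONDITIONAL on the two cited
Poitou–Tate facts `hPT`, `hPT2` ONLY; nothing booked. [cite: JetchevSkinnerWan2017, Thm. 3.3.1 with §3.5 (3.5.c) (arXiv:1512.06894 pp. 11, 15)]
[cite: Castella2018, Thm. 2.3 (arXiv:1704.06608 p. 5)] -/
theorem isTorsion_XAc_empty_of_mult_of_rankOneK_of_poitouTate
    (hPT : ∀ (K : Type) [Field K] [NumberField K], poitouTate_selmerStructure_duality K)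
    (hPT2 : ∀ (K : Type) [Field K] [NumberField K], poitouTate_sha_tateDual K)
    (hp2 : p ≠ 2) (hmult : Mult W p) (hK : IsImaginaryQuadratic K) (hsplit : SplitsIn K p)
    (hrank : (W.baseChange K).mordellWeilRank = 1)
    (hSha : Finite (AddCommGroup.primaryComponent (W.baseChange K).sha p))
    (κ : ZpExtension K p) (hκ : κ.IsAnticyclotomic) (γ : absoluteGaloisGroup K) [Fact (κ.IsTopGenerator γ)]
    (v : HeightOneSpectrum (𝓞 K)) (hv : ((p : ℕ) : 𝓞 K) ∈ v.asIdeal) :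
    Module.IsTorsion (IwasawaAlgebra p) (XAc (W.baseChange K) p κ v ∅ γ) := by
  obtain ⟨P, hP⟩ : ∃ P : (W.baseChange K).toAffine.Point, ¬ IsOfFinAddOrder P :=
    exists_not_isOfFinAddOrder_of_one_le_finrank (M := (W.baseChange K).toAffine.Point)
      (by change 1 ≤ (W.baseChange K).mordellWeilRank; rw [hrank])
  obtain ⟨he, hf⟩ := degreeOne_of_splitsIn hK.1 hsplit hv
  obtain ⟨n, hn, -⟩ := JSWControl.controlOnTreeAt_of_mult_of_rankOne_shaPrimary W p hPT hPT2 hp2 hmult hK hsplit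
    hrank hSha P hP κ hκ γ v hv he hf
  exact hn.1

/-- **The same from `Ш(E/K)` finite** (its `p`-primary component is then finite). CONDITIONAL on `hPT`, `hPT2`.
[cite: JetchevSkinnerWan2017, Thm. 3.3.1 (arXiv:1512.06894 p. 11)] -/
theorem isTorsion_XAc_empty_of_mult_of_rankOneK_of_shaFinite
    (hPT : ∀ (K : Type) [Field K] [NumberField K], poitouTate_selmerStructure_duality K)
    (hPT2 : ∀ (K : Type) [Field K] [NumberField K], poitouTate_sha_tateDual K)
    (hp2 : p ≠ 2) (hmult : Mult W p) (hK : IsImaginaryQuadratic K) (hsplit : SplitsIn K p)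
    (hrank : (W.baseChange K).mordellWeilRank = 1) (hSha : (W.baseChange K).ShaFinite)
    (κ : ZpExtension K p) (hκ : κ.IsAnticyclotomic) (γ : absoluteGaloisGroup K) [Fact (κ.IsTopGenerator γ)]
    (v : HeightOneSpectrum (𝓞 K)) (hv : ((p : ℕ) : 𝓞 K) ∈ v.asIdeal) :
    Module.IsTorsion (IwasawaAlgebra p) (XAc (W.baseChange K) p κ v ∅ γ) := by
  haveI : Finite (W.baseChange K).sha := hSha
  exact isTorsion_XAc_empty_of_mult_of_rankOneK_of_poitouTate W p hPT hPT2 hp2 hmult hK hsplit hrank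
    inferInstance κ hκ γ v hv

end Algebraic

/-! ### §2 `rank E(K) = 1`, `Ш(E/K)` finite on the (0,1)-locus and from `ord_{s=1} L(E/K,s) = 1` -/

section RankOverK

variable (W : WeierstrassCurve ℚ) [W.IsElliptic] {K : Type} [Field K] [NumberField K]

/-- **The (0,1)-locus: `L(E,1) ≠ 0`-shape `r_an(E) = 0` and `r_an(E^{(d_K)}) = 1` give `rank E(K) = 1` and `Ш(E/K)` finite**
— GZK over `ℚ` for `E` (rank `0`, `Ш` finite) and for the twist `E^{(d_K)}` (rank `1`, `Ш` finite), then
`rank E(K) = rank E(ℚ) + rank E^{(d_K)}(ℚ)` (`mordellWeilRank_baseChange_quadratic_holds`) and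
`shaFinite_baseChange_of_shaFinite`. The mirror image of X2's `mordellWeilRank_eq_one_and_shaFinite_of_twist` (the (1,0)-locus).
CONDITIONAL on `hGZK`. [cite: GrossZagier1986, Thm. I.6.3] [cite: Kolyvagin1990, Thm. A] [cite: SilvermanAEC2009, Exercise 10.16]
[cite: DokchitserDokchitserAnnals2010, Lemma 4.14 (proof)] -/
theorem mordellWeilRank_eq_one_and_shaFinite_of_analyticRank_zero_of_twist_one
    (hGZK : rank_eq_analyticRank_of_analyticRank_le_one) (hr : W.analyticRank = 0)
    (h2 : Module.finrank ℚ K = 2) (hrt : (W.quadraticTwist (NumberField.discr K : ℚ)).analyticRank = 1) :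
    (W.baseChange K).mordellWeilRank = 1 ∧ (W.baseChange K).ShaFinite := by
  have hD0 : (NumberField.discr K : ℚ) ≠ 0 := by exact_mod_cast NumberField.discr_ne_zero K
  haveI hEt : (W.quadraticTwist (NumberField.discr K : ℚ)).IsElliptic := W.isElliptic_quadraticTwist hD0
  obtain ⟨hrankW, hShaW⟩ := hGZK W (by rw [hr]; exact zero_le_one)
  obtain ⟨hrankt, hShat⟩ := hGZK (W.quadraticTwist (NumberField.discr K : ℚ)) (le_of_eq hrt)
  refine ⟨?_, ?_⟩
  · rw [mordellWeilRank_baseChange_quadratic_holds W K h2, hrankW, hr, hrankt, hrt]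
  · exact shaFinite_baseChange_of_shaFinite W K h2 hShaW hShat

/-- **`ord_{s=1} L(E/K,s) = 1` ⟹ `rank E(K) = 1` and `Ш(E/K)` finite**, for any quadratic number field `K`, from GZK over `ℚ`
and modularity: `ord L(E/K) = ord L(E) + ord L(E^{(d_K)})` (`analyticRankEK_eq_add_of`, orders of entire non-zero germs add), so
`(r_an(E), r_an(E^{(d_K)})) ∈ {(1,0), (0,1)}`; the (1,0) case is X2's `mordellWeilRank_eq_one_and_shaFinite_of_twist`
(`L(E^{(d_K)},1) ≠ 0` by `analyticRank_eq_zero_iff_holds`), the (0,1) case is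
`mordellWeilRank_eq_one_and_shaFinite_of_analyticRank_zero_of_twist_one`. CONDITIONAL on `hGZK`, `hnf`.
[cite: GrossZagier1986, I.§7 and Thm. I.6.3] [cite: Kolyvagin1990, Thm. A] [cite: JetchevSkinnerWan2017, §7.4.1 (arXiv:1512.06894 p. 30)] -/
theorem mordellWeilRank_eq_one_and_shaFinite_of_analyticRankEK_eq_one
    (hGZK : rank_eq_analyticRank_of_analyticRank_le_one) (hnf : exists_isNewformOf)
    (h2 : Module.finrank ℚ K = 2) (hr : analyticRankEK W K = 1) :
    (W.baseChange K).mordellWeilRank = 1 ∧ (W.baseChange K).ShaFinite := by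
  have hmod : hasEntireLFunction_rat := hasEntireLFunction_rat_of_exists_isNewformOf hnf
  have hD0 : (NumberField.discr K : ℚ) ≠ 0 := by exact_mod_cast NumberField.discr_ne_zero K
  haveI hEt : (W.quadraticTwist (NumberField.discr K : ℚ)).IsElliptic := W.isElliptic_quadraticTwist hD0
  rw [analyticRankEK_eq_add_of hmod W K] at hr
  rcases Nat.eq_zero_or_pos W.analyticRank with h0 | hpos
  · -- the (0,1)-locus
    rw [h0, zero_add] at hr
    exact mordellWeilRank_eq_one_and_shaFinite_of_analyticRank_zero_of_twist_one W hGZK h0 h2 hr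
  · -- the (1,0)-locus
    have h1 : W.analyticRank = 1 := by omega
    have ht : (W.quadraticTwist (NumberField.discr K : ℚ)).analyticRank = 0 := by omega
    have hLt : (W.quadraticTwist (NumberField.discr K : ℚ)).entireLFunction 1 ≠ 0 :=
      ((W.quadraticTwist _).analyticRank_eq_zero_iff_holds (hmod _)).1 ht
    exact X2.mordellWeilRank_eq_one_and_shaFinite_of_twist W hGZK hnf h1 h2 hLt

end RankOverK

/-! ### §3 Torsion at any odd multiplicative `p` from `ord_{s=1} L(E/K,s) = 1` -/

section Analytic

variable (W : WeierstrassCurve ℚ) [W.IsElliptic] [W.IsGloballyMinimal] (p : ℕ) [Fact p.Prime]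
  {K : Type} [Field K] [NumberField K]

/-- **`X^∅_ac(E/K_∞; slot v)` is `Λ`-torsion whenever `ord_{s=1} L(E/K,s) = 1`** (`E/ℚ` globally minimal, `p` odd multiplicative,
`K` imaginary quadratic with `p` split, anticyclotomic `(κ, γ)`, any `v ∋ p`) — BOTH the (1,0)-locus of p613967 and the
(0,1)-locus, with no `X_ac`-transport: §2 feeds §1. CONDITIONAL on `hGZK`, `hnf`, `hPT`, `hPT2`.
[cite: JetchevSkinnerWan2017, Thm. 3.3.1 (arXiv:1512.06894 p. 11)] [cite: Castella2018, Thm. 2.3 (arXiv:1704.06608 p. 5)] -/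
theorem isTorsion_XAc_empty_of_mult_of_analyticRankEK_eq_one_of_facts
    (hGZK : rank_eq_analyticRank_of_analyticRank_le_one) (hnf : exists_isNewformOf)
    (hPT : ∀ (K : Type) [Field K] [NumberField K], poitouTate_selmerStructure_duality K)
    (hPT2 : ∀ (K : Type) [Field K] [NumberField K], poitouTate_sha_tateDual K)
    (hp2 : p ≠ 2) (hmult : Mult W p) (hK : IsImaginaryQuadratic K) (hsplit : SplitsIn K p)
    (hr : analyticRankEK W K = 1)
    (κ : ZpExtension K p) (hκ : κ.IsAnticyclotomic) (γ : absoluteGaloisGroup K) [Fact (κ.IsTopGenerator γ)]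
    (v : HeightOneSpectrum (𝓞 K)) (hv : ((p : ℕ) : 𝓞 K) ∈ v.asIdeal) :
    Module.IsTorsion (IwasawaAlgebra p) (XAc (W.baseChange K) p κ v ∅ γ) := by
  obtain ⟨hrank, hSha⟩ := mordellWeilRank_eq_one_and_shaFinite_of_analyticRankEK_eq_one W hGZK hnf hK.1 hr
  exact isTorsion_XAc_empty_of_mult_of_rankOneK_of_shaFinite W p hPT hPT2 hp2 hmult hK hsplit hrank hSha κ hκ γ v hv

/-- **The (0,1)-locus explicitly**: `L(E,1) ≠ 0`-shape `r_an(E) = 0`, `r_an(E^{(d_K)}) = 1` ⟹ `X^∅_ac(E/K_∞; slot v)` is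
`Λ`-torsion at every odd multiplicative `p` split in `K`. CONDITIONAL on `hGZK`, `hPT`, `hPT2` (no modularity needed here).
[cite: JetchevSkinnerWan2017, Thm. 3.3.1 (arXiv:1512.06894 p. 11)] -/
theorem isTorsion_XAc_empty_of_mult_of_analyticRank_zero_of_twist_one_of_facts
    (hGZK : rank_eq_analyticRank_of_analyticRank_le_one)
    (hPT : ∀ (K : Type) [Field K] [NumberField K], poitouTate_selmerStructure_duality K)
    (hPT2 : ∀ (K : Type) [Field K] [NumberField K], poitouTate_sha_tateDual K)
    (hp2 : p ≠ 2) (hmult : Mult W p) (hK : IsImaginaryQuadratic K) (hsplit : SplitsIn K p)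
    (hr : W.analyticRank = 0) (hrt : (W.quadraticTwist (NumberField.discr K : ℚ)).analyticRank = 1)
    (κ : ZpExtension K p) (hκ : κ.IsAnticyclotomic) (γ : absoluteGaloisGroup K) [Fact (κ.IsTopGenerator γ)]
    (v : HeightOneSpectrum (𝓞 K)) (hv : ((p : ℕ) : 𝓞 K) ∈ v.asIdeal) :
    Module.IsTorsion (IwasawaAlgebra p) (XAc (W.baseChange K) p κ v ∅ γ) := by
  obtain ⟨hrank, hSha⟩ :=
    mordellWeilRank_eq_one_and_shaFinite_of_analyticRank_zero_of_twist_one W hGZK hr hK.1 hrt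
  exact isTorsion_XAc_empty_of_mult_of_rankOneK_of_shaFinite W p hPT hPT2 hp2 hmult hK hsplit hrank hSha κ hκ γ v hv

end Analytic

/-! ### §4 The 3-multiplicative twin: `stub_torsionMult` on the whole `r(W′/K) = 1` locus, and the Road-FF `Σ`-data -/

section Twin

variable (W' : WeierstrassCurve ℚ) [W'.IsElliptic] [W'.IsGloballyMinimal] (N' : ℕ)
  (K : Type) [Field K] [NumberField K]

/-- **`stub_torsionMult` ON THE ALGEBRAIC RANK-ONE LOCUS, modulo Poitou–Tate ×2.** Under the binders of `stub_torsionMult`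
(`Mult W′ 3`, conductor `N′`, `K` imaginary quadratic with `SatisfiesHeegnerHypothesis N′ K` — so `3 ∣ N′` splits —,
anticyclotomic `(κ, γ)`, any `𝔭′ ∋ 3`) PLUS `rank W′(K) = 1` and `Ш(W′/K)[3^∞]` finite: `X^∅_ac(W′/K_∞; slot 𝔭′)` is
`Λ`-torsion. The unused binders of the stub (`Surj`, `d_K` odd) are not taken. CONDITIONAL on `hPT`, `hPT2`; nothing booked.
[cite: JetchevSkinnerWan2017, Thm. 3.3.1 (arXiv:1512.06894 p. 11)] [cite: Castella2018, Thm. 2.3 (arXiv:1704.06608 p. 5)] -/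
theorem twin_isTorsion_XAc_empty_of_rankOneK_of_poitouTate
    (hPT : ∀ (K : Type) [Field K] [NumberField K], poitouTate_selmerStructure_duality K)
    (hPT2 : ∀ (K : Type) [Field K] [NumberField K], poitouTate_sha_tateDual K)
    (hm : Mult W' 3) (hN : W'.conductorNorm ℤ = N') (hK : IsImaginaryQuadratic K)
    (hH : SatisfiesHeegnerHypothesis N' K)
    (hrank : (W'.baseChange K).mordellWeilRank = 1)
    (hSha : Finite (AddCommGroup.primaryComponent (W'.baseChange K).sha 3))
    (κ : ZpExtension K 3) (hκ : κ.IsAnticyclotomic) (γ : absoluteGaloisGroup K) [Fact (κ.IsTopGenerator γ)]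
    (𝔭' : HeightOneSpectrum (𝓞 K)) (h𝔭' : ((3 : ℕ) : 𝓞 K) ∈ 𝔭'.asIdeal) :
    Module.IsTorsion (IwasawaAlgebra 3) (XAc (W'.baseChange K) 3 κ 𝔭' ∅ γ) := by
  have hsplit : SplitsIn K 3 := hH 3 Nat.prime_three (hN ▸ dvd_conductorNorm_of_mult hm)
  exact isTorsion_XAc_empty_of_mult_of_rankOneK_of_poitouTate W' 3 hPT hPT2 (by norm_num) hm hK hsplit hrank hSha
    κ hκ γ 𝔭' h𝔭'

/-- **`stub_torsionMult` ON THE ANALYTIC RANK-ONE LOCUS `ord_{s=1} L(W′/K,s) = 1`, modulo four cited facts** — both the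
(1,0)-locus of p613967 and the (0,1)-locus «`L(W′,1) ≠ 0`, `r_an(W′^{(d_K)}) = 1`». Under the Heegner hypothesis the order is
odd, so the research content of the stub is confined to `ord_{s=1} L(W′/K,s) ≥ 3`. CONDITIONAL on `hGZK`, `hnf`, `hPT`,
`hPT2`; nothing booked; BSD is proved for no curve. [cite: JetchevSkinnerWan2017, Thm. 3.3.1 and §7.4.1 (arXiv:1512.06894 pp. 11, 30)]
[cite: GrossZagier1986, I.§7] -/
theorem twin_isTorsion_XAc_empty_of_analyticRankEK_eq_one_of_facts
    (hGZK : rank_eq_analyticRank_of_analyticRank_le_one) (hnf : exists_isNewformOf)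
    (hPT : ∀ (K : Type) [Field K] [NumberField K], poitouTate_selmerStructure_duality K)
    (hPT2 : ∀ (K : Type) [Field K] [NumberField K], poitouTate_sha_tateDual K)
    (hm : Mult W' 3) (hN : W'.conductorNorm ℤ = N') (hK : IsImaginaryQuadratic K)
    (hH : SatisfiesHeegnerHypothesis N' K) (hr : analyticRankEK W' K = 1)
    (κ : ZpExtension K 3) (hκ : κ.IsAnticyclotomic) (γ : absoluteGaloisGroup K) [Fact (κ.IsTopGenerator γ)]
    (𝔭' : HeightOneSpectrum (𝓞 K)) (h𝔭' : ((3 : ℕ) : 𝓞 K) ∈ 𝔭'.asIdeal) :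
    Module.IsTorsion (IwasawaAlgebra 3) (XAc (W'.baseChange K) 3 κ 𝔭' ∅ γ) := by
  have hsplit : SplitsIn K 3 := hH 3 Nat.prime_three (hN ▸ dvd_conductorNorm_of_mult hm)
  exact isTorsion_XAc_empty_of_mult_of_analyticRankEK_eq_one_of_facts W' 3 hGZK hnf hPT hPT2 (by norm_num) hm hK hsplit
    hr κ hκ γ 𝔭' h𝔭'

/-- **`stub_torsionMult` ON THE (0,1)-LOCUS explicitly** (`r_an(W′) = 0`, `r_an(W′^{(d_K)}) = 1`), the case p613967 left as
«needs an `X_ac`-transport»: it needs none. CONDITIONAL on `hGZK`, `hPT`, `hPT2`.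
[cite: JetchevSkinnerWan2017, Thm. 3.3.1 (arXiv:1512.06894 p. 11)] -/
theorem twin_isTorsion_XAc_empty_of_analyticRank_zero_of_twist_one_of_facts
    (hGZK : rank_eq_analyticRank_of_analyticRank_le_one)
    (hPT : ∀ (K : Type) [Field K] [NumberField K], poitouTate_selmerStructure_duality K)
    (hPT2 : ∀ (K : Type) [Field K] [NumberField K], poitouTate_sha_tateDual K)
    (hm : Mult W' 3) (hN : W'.conductorNorm ℤ = N') (hK : IsImaginaryQuadratic K)
    (hH : SatisfiesHeegnerHypothesis N' K)
    (hr : W'.analyticRank = 0) (hrt : (W'.quadraticTwist (NumberField.discr K : ℚ)).analyticRank = 1)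
    (κ : ZpExtension K 3) (hκ : κ.IsAnticyclotomic) (γ : absoluteGaloisGroup K) [Fact (κ.IsTopGenerator γ)]
    (𝔭' : HeightOneSpectrum (𝓞 K)) (h𝔭' : ((3 : ℕ) : 𝓞 K) ∈ 𝔭'.asIdeal) :
    Module.IsTorsion (IwasawaAlgebra 3) (XAc (W'.baseChange K) 3 κ 𝔭' ∅ γ) := by
  have hsplit : SplitsIn K 3 := hH 3 Nat.prime_three (hN ▸ dvd_conductorNorm_of_mult hm)
  exact isTorsion_XAc_empty_of_mult_of_analyticRank_zero_of_twist_one_of_facts W' 3 hGZK hPT hPT2 (by norm_num) hm hK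
    hsplit hr hrt κ hκ γ 𝔭' h𝔭'

/-- **v5's `stub_sigmaDataMult` ∕ v7's DERIVED `sigmaDataMult_of_stubs` ON THE ALGEBRAIC RANK-ONE LOCUS**: under the stub's
binders plus `rank W′(K) = 1` and `Ш(W′/K)[3^∞]` finite, the Road-FF `Σ`-data at the X-slot `𝔭′` holds — §4 torsion fed to
p613967's `twin_sigmaDataAt_of_isTorsion_empty'` (Shapiro SU14 3.2.3 and the local `Σ`-display are tree theorems there).
CONDITIONAL on `hPT`, `hPT2` ONLY. [cite: JetchevSkinnerWan2017, Thm. 3.3.1 and §5.1] [cite: SkinnerUrban2014, Prop. 3.2.3] -/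
theorem twin_sigmaDataMult_of_rankOneK_of_poitouTate
    (hPT : ∀ (K : Type) [Field K] [NumberField K], poitouTate_selmerStructure_duality K)
    (hPT2 : ∀ (K : Type) [Field K] [NumberField K], poitouTate_sha_tateDual K)
    (hm : Mult W' 3) (hN : W'.conductorNorm ℤ = N') (hK : IsImaginaryQuadratic K)
    (hH : SatisfiesHeegnerHypothesis N' K)
    (hrank : (W'.baseChange K).mordellWeilRank = 1)
    (hSha : Finite (AddCommGroup.primaryComponent (W'.baseChange K).sha 3))
    (κ : ZpExtension K 3) (hκ : κ.IsAnticyclotomic) (γ : absoluteGaloisGroup K) [Fact (κ.IsTopGenerator γ)]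
    (𝔭' : HeightOneSpectrum (𝓞 K)) (h𝔭' : ((3 : ℕ) : 𝓞 K) ∈ 𝔭'.asIdeal) :
    P2.RoadFF.SigmaDataAt W' 3 κ 𝔭' γ (↑(W'.sigmaPlacesFinset 3 K) : Set (HeightOneSpectrum (𝓞 K)))
      (W'.sigmaEulerElement 3 K κ) :=
  twin_sigmaDataAt_of_isTorsion_empty' W' N' K hm hN hK hH κ hκ γ 𝔭' h𝔭'
    (twin_isTorsion_XAc_empty_of_rankOneK_of_poitouTate W' N' K hPT hPT2 hm hN hK hH hrank hSha κ hκ γ 𝔭' h𝔭')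

/-- **v5's `stub_sigmaDataMult` ∕ v7's `sigmaDataMult_of_stubs` ON THE ANALYTIC RANK-ONE LOCUS `ord_{s=1} L(W′/K,s) = 1`**,
modulo the four cited facts. [cite: JetchevSkinnerWan2017, Thm. 3.3.1 and §5.1] [cite: SkinnerUrban2014, Prop. 3.2.3] -/
theorem twin_sigmaDataMult_of_analyticRankEK_eq_one_of_facts
    (hGZK : rank_eq_analyticRank_of_analyticRank_le_one) (hnf : exists_isNewformOf)
    (hPT : ∀ (K : Type) [Field K] [NumberField K], poitouTate_selmerStructure_duality K)
    (hPT2 : ∀ (K : Type) [Field K] [NumberField K], poitouTate_sha_tateDual K)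
    (hm : Mult W' 3) (hN : W'.conductorNorm ℤ = N') (hK : IsImaginaryQuadratic K)
    (hH : SatisfiesHeegnerHypothesis N' K) (hr : analyticRankEK W' K = 1)
    (κ : ZpExtension K 3) (hκ : κ.IsAnticyclotomic) (γ : absoluteGaloisGroup K) [Fact (κ.IsTopGenerator γ)]
    (𝔭' : HeightOneSpectrum (𝓞 K)) (h𝔭' : ((3 : ℕ) : 𝓞 K) ∈ 𝔭'.asIdeal) :
    P2.RoadFF.SigmaDataAt W' 3 κ 𝔭' γ (↑(W'.sigmaPlacesFinset 3 K) : Set (HeightOneSpectrum (𝓞 K)))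
      (W'.sigmaEulerElement 3 K κ) :=
  twin_sigmaDataAt_of_isTorsion_empty' W' N' K hm hN hK hH κ hκ γ 𝔭' h𝔭'
    (twin_isTorsion_XAc_empty_of_analyticRankEK_eq_one_of_facts W' N' K hGZK hnf hPT hPT2 hm hN hK hH hr κ hκ γ 𝔭' h𝔭')

end Twin

end Summit.BirchSwinnertonDyer.BirchSwinnertonDyer.Theorems.UniversalToricDescentTwinTorsionRankOneK

end
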